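import Literature.AnabelianGeometry.AbsoluteAnabelian.AbsTopICharacterRankWithTrivial
import Literature.AnabelianGeometry.AbsoluteAnabelian.AbsTopICharacterRankLem45iiiClosures
import HarnessLib

/-!
# [AbsTopI] Lemma 4.5 (ii)/(iii): `τ`, `d_χ`, `det` and the realised weights of a DIRECT SUM

Proof-only companion of `AbsTopICharacterRank.lean` (S. Mochizuki, *Topics in Absolute Anabelian
Geometry I: Generalities* [MochizukiAbsTopI2012], Lemma 4.5 (ii), (iii), kurims manuscript p. 54;
[CombGC] = S. Mochizuki, *A combinatorial version of the Grothendieck conjecture* [MochizukiCombGC2007],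
Def. 2.3 / Prop. 2.4 pp. 18–20), cell abc-iut, block F, seat abc-iut-f-062 (FACT-LIST rows F-0222
`Lem45iii_cuspCount`, F-0223 `Lem45iii_cycloClass`, F-0224 `Lem45iii_det`, F-0225 `RealisedWeight` —
schemata over an INPUT `G`-module `V`).  Print's modules are direct sums throughout ("`(H^{ab} ⊗ ℚ_l)
⊕ ℚ_l`", p. 54; [CombGC] Prop. 2.4's `M_G ⊗ ℤ_l = M^{vert} ⊕ …` filtration pieces), and the weight
calculus is used summand by summand.  This file supplies that calculus in the kernel for an
arbitrary direct sum `V ⊕ W` of two `G`-modules — stated for ANY representation `ρ` on `V × W`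
acting componentwise through `ρ₁`, `ρ₂` (hypothesis `hρ : ∀ g x, ρ g x = (ρ₁ g x.1, ρ₂ g x.2)`; such
a `ρ` EXISTS, `exists_prodRep`, and the trunk's `withTrivial ρ₁` is the case `ρ₂ = 1` on `W = K`,
`withTrivial_eq_prod`), so no new definition is introduced:

* `quasiTrivialRank_prod` — **`τ(V ⊕ W) = τ(V) + τ(W)`** (additivity of `τ` in the split exact
  sequence `0 → V → V ⊕ W → W → 0`, from `quasiTrivialRank_eq_add_of_exact`); with twists,
  `quasiTrivialRank_twist_prod`;
* `detChar_prod` — `det(V ⊕ W) = det(V)·det(W)`; `dChi_prod` — **`d_χ(V ⊕ W) = d_χ(V) + d_χ(W)`**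
  (uses A10 `τ(Hom(M, K)) = τ(M)`, `dualRankEq_holds`);
* `realisedWeight_prod_iff` — **the weights realised by `(V ⊕ W) ⊕ ℚ_l` are the UNION of those
  realised by `V ⊕ ℚ_l` and by `W ⊕ ℚ_l`** (F-0225 on direct sums); hence A7
  `RealisedWeightsSymmetric` ([CombGC] Prop. 2.4 (vii)) and F-0223 `Lem45iii_cycloClass` pass to direct
  sums of modules each satisfying A7 (`realisedWeightsSymmetric_prod`, `lem45iii_cycloClass_prod`);
* F-0224 / A3 on direct sums: `lem45iii_det_prod` (weights of determinant characters ADD, so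
  positivity is preserved), `detSqQuasiCyclotomic_prod` (exponents `m` add, `m ≤ 2·dim` preserved);
* F-0222 / A9 on direct sums: `lem45iii_cuspCount_prod_iff`, `cuspCountViaWeights_prod_iff` (the
  count `d_χ + 1` of a sum is `n₁ + n₂ − 1`).
The hyperbolic-curve shape `V(ψ) ⊕ K(χ^{cyclo}) ⊕ V'(χ^{cyclo})` (split model ⊕ pure-cyclotomic model)
is read off with these rules in the sequel `AbsTopICharacterRankCurveShape.lean`.
No new definitions.  HONEST FRAMING: refereed pre-IUT anabelian geometry (linear algebra of
`G`-modules); nothing here bears on [IUTchIII] Cor. 3.12.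
-/

noncomputable section

open scoped Classical

namespace Literature.AnabelianGeometry.AbsoluteAnabelian.AbsTopI

universe u v w w'

section DirectSum

variable {G : Type u} [Group G] [TopologicalSpace G]
variable {K : Type v} [Field K]
variable {V : Type w} [AddCommGroup V] [Module K V]
variable {W : Type w'} [AddCommGroup W] [Module K W]

/-! ### The direct-sum representation exists; `withTrivial` is a direct sum -/

omit [TopologicalSpace G] in
/-- The direct sum `V ⊕ W` of two `G`-modules: a representation on `V × W` acting componentwise
through `ρ₁` and `ρ₂` EXISTS (`g ↦ ρ₁(g) × ρ₂(g)`).  All results below are stated for any such `ρ`.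
[cite: MochizukiAbsTopI2012, Lemma 4.5 (iii) p.54] -/
theorem exists_prodRep (ρ₁ : G →* (V ≃ₗ[K] V)) (ρ₂ : G →* (W ≃ₗ[K] W)) :
    ∃ ρ : G →* ((V × W) ≃ₗ[K] (V × W)), ∀ (g : G) (x : V × W), ρ g x = (ρ₁ g x.1, ρ₂ g x.2) :=
  ⟨{ toFun := fun g => (ρ₁ g).prodCongr (ρ₂ g)
     map_one' := by ext x <;> simp
     map_mul' := fun g h => by ext x <;> simp }, fun _ _ => rfl⟩

omit [TopologicalSpace G] in
/-- The trunk's "`V ⊕ ℚ_l` with the trivial action on `ℚ_l`" is the direct sum of `ρV` with the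
trivial representation on the line `K`. [cite: MochizukiAbsTopI2012, Lemma 4.5 (iii) p.54] -/
theorem withTrivial_eq_prod (ρV : G →* (V ≃ₗ[K] V)) (g : G) (x : V × K) :
    withTrivial ρV g x = (ρV g x.1, (1 : G →* (K ≃ₗ[K] K)) g x.2) := rfl

omit [TopologicalSpace G] in
/-- Twisting a direct sum twists the summands: `(V ⊕ W)(χ) = V(χ) ⊕ W(χ)`.
[cite: MochizukiAbsTopI2012, Lemma 4.5 (ii) p.54] -/
theorem twist_prod_apply {ρ₁ : G →* (V ≃ₗ[K] V)} {ρ₂ : G →* (W ≃ₗ[K] W)}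
    {ρ : G →* ((V × W) ≃ₗ[K] (V × W))} (hρ : ∀ (g : G) (x : V × W), ρ g x = (ρ₁ g x.1, ρ₂ g x.2))
    (χ : G →* Kˣ) (g : G) (x : V × W) :
    twist ρ χ g x = (twist ρ₁ χ g x.1, twist ρ₂ χ g x.2) := by
  rw [twist_apply, twist_apply, twist_apply, hρ]
  rfl

/-! ### `τ(V ⊕ W) = τ(V) + τ(W)` -/

/-- **`τ(V ⊕ W) = τ(V) + τ(W)`**: the quasi-trivial rank ([AbsTopI] Lemma 4.5 (ii), [CombGC]
Def. 2.3 (i)) is additive on direct sums — additivity along the stable submodule `V ⊕ 0`, whose sub-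
resp. quotient representation is isomorphic to `V` resp. `W`.
[cite: MochizukiAbsTopI2012, Lemma 4.5 (ii) p.54] [cite: MochizukiCombGC2007, Def. 2.3 (i) p.18] -/
theorem quasiTrivialRank_prod [FiniteDimensional K V] [FiniteDimensional K W]
    {ρ₁ : G →* (V ≃ₗ[K] V)} {ρ₂ : G →* (W ≃ₗ[K] W)} {ρ : G →* ((V × W) ≃ₗ[K] (V × W))}
    (hρ : ∀ (g : G) (x : V × W), ρ g x = (ρ₁ g x.1, ρ₂ g x.2)) :
    quasiTrivialRank ρ = quasiTrivialRank ρ₁ + quasiTrivialRank ρ₂ := by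
  let N : Submodule K (V × W) := LinearMap.range (LinearMap.inl K V W)
  have hN : IsStable ρ N := by
    rintro g _ ⟨v, rfl⟩
    exact ⟨ρ₁ g v, by rw [hρ]; simp⟩
  obtain ⟨ρN, ρQ, hρN, hρQ, hadd⟩ := exists_quasiTrivialRank_eq_add ρ hN
  rw [hadd]
  congr 1
  · -- `V ≅` the subrepresentation on `V ⊕ 0`
    symm
    let eV : V ≃ₗ[K] ↥N := LinearEquiv.ofInjective (LinearMap.inl K V W) LinearMap.inl_injective
    have h1 : ∀ v : V, ((eV v : ↥N) : V × W) = (v, 0) := fun v => rfl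
    refine quasiTrivialRank_eq_of_equivariant eV fun g v => ?_
    apply Subtype.ext
    rw [hρN, h1, h1, hρ]
    simp
  · -- `W ≅` the quotient representation on `(V ⊕ W)/(V ⊕ 0)`
    symm
    have hinj : Function.Injective (N.mkQ.comp (LinearMap.inr K V W)) := by
      intro c₁ c₂ h
      have h' : (LinearMap.inr K V W c₁ - LinearMap.inr K V W c₂) ∈ N := (Submodule.Quotient.eq N).1 h
      obtain ⟨v, hv⟩ := h'
      have := congrArg Prod.snd hv
      simp at this
      exact sub_eq_zero.1 this.symm
    have hsurj : Function.Surjective (N.mkQ.comp (LinearMap.inr K V W)) := by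
      intro x
      obtain ⟨⟨v, c⟩, rfl⟩ := N.mkQ_surjective x
      refine ⟨c, (Submodule.Quotient.eq N).2 ⟨-v, ?_⟩⟩
      simp
    let eW : W ≃ₗ[K] ((V × W) ⧸ N) := LinearEquiv.ofBijective _ ⟨hinj, hsurj⟩
    have h2 : ∀ c : W, eW c = N.mkQ ((0 : V), c) := fun c => rfl
    refine quasiTrivialRank_eq_of_equivariant eW fun g c => ?_
    rw [h2, h2, hρQ, hρ]
    simp

/-- `τ((V ⊕ W)(χ)) = τ(V(χ)) + τ(W(χ))`. [cite: MochizukiAbsTopI2012, Lemma 4.5 (ii) p.54] -/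
theorem quasiTrivialRank_twist_prod [FiniteDimensional K V] [FiniteDimensional K W]
    {ρ₁ : G →* (V ≃ₗ[K] V)} {ρ₂ : G →* (W ≃ₗ[K] W)} {ρ : G →* ((V × W) ≃ₗ[K] (V × W))}
    (hρ : ∀ (g : G) (x : V × W), ρ g x = (ρ₁ g x.1, ρ₂ g x.2)) (χ : G →* Kˣ) :
    quasiTrivialRank (twist ρ χ) = quasiTrivialRank (twist ρ₁ χ) + quasiTrivialRank (twist ρ₂ χ) :=
  quasiTrivialRank_prod (twist_prod_apply hρ χ)

/-! ### `det(V ⊕ W) = det(V)·det(W)` and `d_χ(V ⊕ W) = d_χ(V) + d_χ(W)` -/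

omit [TopologicalSpace G] in
/-- **The determinant character of a direct sum is the product of the determinant characters.**
[cite: MochizukiAbsTopI2012, Lemma 4.5 (iii) p.54] -/
theorem detChar_prod [FiniteDimensional K V] [FiniteDimensional K W]
    {ρ₁ : G →* (V ≃ₗ[K] V)} {ρ₂ : G →* (W ≃ₗ[K] W)} {ρ : G →* ((V × W) ≃ₗ[K] (V × W))}
    (hρ : ∀ (g : G) (x : V × W), ρ g x = (ρ₁ g x.1, ρ₂ g x.2)) :
    detChar ρ = detChar ρ₁ * detChar ρ₂ := by
  ext g
  have hg : ρ g = (ρ₁ g).prodCongr (ρ₂ g) := by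
    ext x
    · rw [hρ, LinearEquiv.prodCongr_apply]
    · rw [hρ, LinearEquiv.prodCongr_apply]
  simp only [detChar, MonoidHom.coe_comp, Function.comp_apply, MonoidHom.mul_apply, Units.val_mul,
    LinearEquiv.coe_det, hg, LinearEquiv.coe_prodCongr, LinearMap.det_prodMap]

/-- **`d_χ(V ⊕ W) = d_χ(V) + d_χ(W)`** ([AbsTopI] Lemma 4.5 (ii) "`d_χ(M) := τ(M(χ⁻¹)) −
τ(Hom(M, ℚ_l))`"): both terms are additive on direct sums (`τ(Hom(M, K)) = τ(M)`, sub-node A10,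
`dualRankEq_holds`). [cite: MochizukiAbsTopI2012, Lemma 4.5 (ii) p.54] -/
theorem dChi_prod [FiniteDimensional K V] [FiniteDimensional K W]
    {ρ₁ : G →* (V ≃ₗ[K] V)} {ρ₂ : G →* (W ≃ₗ[K] W)} {ρ : G →* ((V × W) ≃ₗ[K] (V × W))}
    (hρ : ∀ (g : G) (x : V × W), ρ g x = (ρ₁ g x.1, ρ₂ g x.2)) (χ : G →* Kˣ) :
    dChi ρ χ = dChi ρ₁ χ + dChi ρ₂ χ := by
  have h := dualRankEq_holds ρ
  have h₁ := dualRankEq_holds ρ₁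
  have h₂ := dualRankEq_holds ρ₂
  unfold DualRankEq at h h₁ h₂
  unfold dChi
  rw [h, h₁, h₂, quasiTrivialRank_twist_prod hρ, quasiTrivialRank_prod hρ]
  push_cast
  ring

/-! ### F-0225 on direct sums: realised weights of `(V ⊕ W) ⊕ ℚ_l` = union -/

/-- **The weights realised by `(V ⊕ W) ⊕ ℚ_l` are exactly those realised by `V ⊕ ℚ_l` or by
`W ⊕ ℚ_l`** ([AbsTopI] Lemma 4.5 (iii) "`τ(M(χ•⁻¹)) ≠ 0` for some subquotient of `(H^{ab} ⊗ ℚ_l) ⊕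
ℚ_l`"; [CombGC] Prop. 2.4 (vii) `{0} ∪ w_l(−)`): `τ` of the twisted `(V ⊕ W) ⊕ K` is
`τ(V(χ⁻¹)) + τ(W(χ⁻¹)) + τ(K(χ⁻¹))`, nonzero iff one of the two partial sums with `τ(K(χ⁻¹))` is.
[cite: MochizukiAbsTopI2012, Lemma 4.5 (iii) p.54] [cite: MochizukiCombGC2007, Prop. 2.4 (vii) p.20] -/
theorem realisedWeight_prod_iff [FiniteDimensional K V] [FiniteDimensional K W] (χcyclo : G →* Kˣ)
    {ρ₁ : G →* (V ≃ₗ[K] V)} {ρ₂ : G →* (W ≃ₗ[K] W)} {ρ : G →* ((V × W) ≃ₗ[K] (V × W))}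
    (hρ : ∀ (g : G) (x : V × W), ρ g x = (ρ₁ g x.1, ρ₂ g x.2)) (w : ℚ) :
    RealisedWeight χcyclo ρ w ↔ RealisedWeight χcyclo ρ₁ w ∨ RealisedWeight χcyclo ρ₂ w := by
  have key : ∀ χ : G →* Kˣ, quasiTrivialRank (twist (withTrivial ρ) χ⁻¹) ≠ 0 ↔
      quasiTrivialRank (twist (withTrivial ρ₁) χ⁻¹) ≠ 0 ∨
        quasiTrivialRank (twist (withTrivial ρ₂) χ⁻¹) ≠ 0 := by
    intro χ
    rw [quasiTrivialRank_twist_withTrivial, quasiTrivialRank_twist_withTrivial,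
      quasiTrivialRank_twist_withTrivial, quasiTrivialRank_twist_prod hρ]
    omega
  unfold RealisedWeight
  constructor
  · rintro ⟨χ, hχ, hne⟩
    rcases (key χ).1 hne with h | h
    · exact Or.inl ⟨χ, hχ, h⟩
    · exact Or.inr ⟨χ, hχ, h⟩
  · rintro (⟨χ, hχ, h⟩ | ⟨χ, hχ, h⟩)
    · exact ⟨χ, hχ, (key χ).2 (Or.inl h)⟩
    · exact ⟨χ, hχ, (key χ).2 (Or.inr h)⟩

/-- The realised-weight SET of a direct sum is the union of the summands' sets.
[cite: MochizukiAbsTopI2012, Lemma 4.5 (iii) p.54] [cite: MochizukiCombGC2007, Prop. 2.4 (vii) p.20] -/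
theorem setOf_realisedWeight_prod [FiniteDimensional K V] [FiniteDimensional K W] (χcyclo : G →* Kˣ)
    {ρ₁ : G →* (V ≃ₗ[K] V)} {ρ₂ : G →* (W ≃ₗ[K] W)} {ρ : G →* ((V × W) ≃ₗ[K] (V × W))}
    (hρ : ∀ (g : G) (x : V × W), ρ g x = (ρ₁ g x.1, ρ₂ g x.2)) :
    {w : ℚ | RealisedWeight χcyclo ρ w} =
      {w : ℚ | RealisedWeight χcyclo ρ₁ w} ∪ {w : ℚ | RealisedWeight χcyclo ρ₂ w} := by
  ext w
  simp only [Set.mem_setOf_eq, Set.mem_union, realisedWeight_prod_iff χcyclo hρ]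

/-- **A7 passes to direct sums**: if the realised weights of `V ⊕ ℚ_l` and of `W ⊕ ℚ_l` are finite
and symmetric under `λ ↦ 2 − λ` ([CombGC] Prop. 2.4 (vii)), so are those of `(V ⊕ W) ⊕ ℚ_l`.
[cite: MochizukiCombGC2007, Prop. 2.4 (vii) p.20] [cite: MochizukiAbsTopI2012, Lemma 4.5 (iii) p.54] -/
theorem realisedWeightsSymmetric_prod [FiniteDimensional K V] [FiniteDimensional K W]
    {χcyclo : G →* Kˣ} {ρ₁ : G →* (V ≃ₗ[K] V)} {ρ₂ : G →* (W ≃ₗ[K] W)}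
    {ρ : G →* ((V × W) ≃ₗ[K] (V × W))}
    (hρ : ∀ (g : G) (x : V × W), ρ g x = (ρ₁ g x.1, ρ₂ g x.2))
    (h₁ : RealisedWeightsSymmetric χcyclo ρ₁) (h₂ : RealisedWeightsSymmetric χcyclo ρ₂) :
    RealisedWeightsSymmetric χcyclo ρ := by
  refine ⟨?_, fun w => ?_⟩
  · rw [setOf_realisedWeight_prod χcyclo hρ]
    exact h₁.1.union h₂.1
  · rw [realisedWeight_prod_iff χcyclo hρ, realisedWeight_prod_iff χcyclo hρ, h₁.2 w, h₂.2 w]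

/-- **F-0223 on direct sums**: [AbsTopI] Lemma 4.5 (iii), second sentence (the max/min-weight
characterisation of the class of `χ^{cyclo}`), holds for `V ⊕ W` as soon as each summand satisfies
the printed input A7 ([CombGC] Prop. 2.4 (vii)). [cite: MochizukiAbsTopI2012, Lemma 4.5 (iii) p.54]
[cite: MochizukiCombGC2007, Prop. 2.4 (vii) p.20] -/
theorem lem45iii_cycloClass_prod [FiniteDimensional K V] [FiniteDimensional K W]
    {χcyclo : G →* Kˣ} {ρ₁ : G →* (V ≃ₗ[K] V)} {ρ₂ : G →* (W ≃ₗ[K] W)}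
    {ρ : G →* ((V × W) ≃ₗ[K] (V × W))}
    (hρ : ∀ (g : G) (x : V × W), ρ g x = (ρ₁ g x.1, ρ₂ g x.2))
    (h₁ : RealisedWeightsSymmetric χcyclo ρ₁) (h₂ : RealisedWeightsSymmetric χcyclo ρ₂) :
    Lem45iii_cycloClass χcyclo ρ :=
  lem45iii_cycloClass_of_realisedWeightsSymmetric χcyclo ρ (realisedWeightsSymmetric_prod hρ h₁ h₂)

/-! ### F-0224 / A3 on direct sums -/

omit [TopologicalSpace G] in
/-- **F-0224 on direct sums**: if the determinant characters of `V` and `W` are `ℚ`-cyclotomic of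
positive weights `w₁`, `w₂`, then that of `V ⊕ W` (their product) is `ℚ`-cyclotomic of the positive
weight `w₁ + w₂`. [cite: MochizukiAbsTopI2012, Lemma 4.5 (iii) p.54] [cite: MochizukiCombGC2007, Def. 2.3 (ii) p.18] -/
theorem lem45iii_det_prod [FiniteDimensional K V] [FiniteDimensional K W]
    {χcyclo : G →* Kˣ} {ρ₁ : G →* (V ≃ₗ[K] V)} {ρ₂ : G →* (W ≃ₗ[K] W)}
    {ρ : G →* ((V × W) ≃ₗ[K] (V × W))}
    (hρ : ∀ (g : G) (x : V × W), ρ g x = (ρ₁ g x.1, ρ₂ g x.2))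
    (h₁ : Lem45iii_det χcyclo ρ₁) (h₂ : Lem45iii_det χcyclo ρ₂) : Lem45iii_det χcyclo ρ := by
  obtain ⟨w₁, hw₁, hc₁⟩ := h₁
  obtain ⟨w₂, hw₂, hc₂⟩ := h₂
  refine ⟨w₁ + w₂, add_pos hw₁ hw₂, ?_⟩
  rw [detChar_prod hρ]
  exact isQCyclotomicOfWeightK_mul hc₁ hc₂

omit [TopologicalSpace G] in
/-- The dimension of a direct sum. [cite: MochizukiAbsTopI2012, Lemma 4.5 (iii) p.54] -/
theorem finrank_prod_eq [FiniteDimensional K V] [FiniteDimensional K W] :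
    Module.finrank K (V × W) = Module.finrank K V + Module.finrank K W :=
  Module.finrank_prod

/-- **A3 passes to direct sums** ([CombGC] Prop. 2.4 (iii): "`det(−)^{⊗2}(−m)` is quasi-trivial for
some `0 < m ≤ 2·rank`"): the exponents add (`m = m₁ + m₂ ≤ 2·dim V + 2·dim W = 2·dim(V ⊕ W)`), on the
intersection of the two open subgroups of finite index. [cite: MochizukiCombGC2007, Prop. 2.4 (iii) p.19]
[cite: MochizukiAbsTopI2012, Lemma 4.5 (iii) p.54] -/
theorem detSqQuasiCyclotomic_prod [FiniteDimensional K V] [FiniteDimensional K W]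
    {χcyclo : G →* Kˣ} {ρ₁ : G →* (V ≃ₗ[K] V)} {ρ₂ : G →* (W ≃ₗ[K] W)}
    {ρ : G →* ((V × W) ≃ₗ[K] (V × W))}
    (hρ : ∀ (g : G) (x : V × W), ρ g x = (ρ₁ g x.1, ρ₂ g x.2))
    (h₁ : DetSqQuasiCyclotomic χcyclo ρ₁) (h₂ : DetSqQuasiCyclotomic χcyclo ρ₂) :
    DetSqQuasiCyclotomic χcyclo ρ := by
  obtain ⟨m₁, hm₁, hle₁, U₁, hU₁, hfi₁, hact₁⟩ := h₁
  obtain ⟨m₂, _, hle₂, U₂, hU₂, hfi₂, hact₂⟩ := h₂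
  haveI := hfi₁
  haveI := hfi₂
  refine ⟨m₁ + m₂, by omega, ?_, U₁ ⊓ U₂, hU₁.inter hU₂, inferInstance, fun g hg => ?_⟩
  · rw [Module.finrank_prod]
    omega
  · rw [detChar_prod hρ, MonoidHom.mul_apply, mul_pow, hact₁ g hg.1, hact₂ g hg.2, ← pow_add]

/-! ### F-0222 / A9 on direct sums -/

/-- **F-0222 on direct sums**: `Lem45iii_cuspCount χ (V ⊕ W) n` reads `n = d_χ(V) + d_χ(W) + 1`; so if
`V` and `W` carry the counts `n₁ = d_χ(V) + 1`, `n₂ = d_χ(W) + 1`, the direct sum carries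
`n = n₁ + n₂ − 1`. [cite: MochizukiAbsTopI2012, Lemma 4.5 (iii) p.54] -/
theorem lem45iii_cuspCount_prod_iff [FiniteDimensional K V] [FiniteDimensional K W]
    {χcyclo : G →* Kˣ} {ρ₁ : G →* (V ≃ₗ[K] V)} {ρ₂ : G →* (W ≃ₗ[K] W)}
    {ρ : G →* ((V × W) ≃ₗ[K] (V × W))}
    (hρ : ∀ (g : G) (x : V × W), ρ g x = (ρ₁ g x.1, ρ₂ g x.2)) {n₁ n₂ : ℕ}
    (h₁ : Lem45iii_cuspCount χcyclo ρ₁ n₁) (h₂ : Lem45iii_cuspCount χcyclo ρ₂ n₂) (n : ℕ) :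
    Lem45iii_cuspCount χcyclo ρ n ↔ (n : ℤ) = n₁ + n₂ - 1 := by
  unfold Lem45iii_cuspCount at h₁ h₂ ⊢
  rw [dChi_prod hρ]
  constructor <;> intro h <;> linarith

/-- **A9 on direct sums** ([CombGC] Cor. 2.7 (i) weight count `τ(V((χ^{cyclo})⁻¹)) − τ(V) + 1 = n`):
both ranks are additive, so counts `n₁`, `n₂` for `V`, `W` give the count `n₁ + n₂ − 1` for `V ⊕ W`.
[cite: MochizukiCombGC2007, Cor. 2.7 (i) proof p.23] [cite: MochizukiAbsTopI2012, Lemma 4.5 (iii) p.54] -/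
theorem cuspCountViaWeights_prod_iff [FiniteDimensional K V] [FiniteDimensional K W]
    {χcyclo : G →* Kˣ} {ρ₁ : G →* (V ≃ₗ[K] V)} {ρ₂ : G →* (W ≃ₗ[K] W)}
    {ρ : G →* ((V × W) ≃ₗ[K] (V × W))}
    (hρ : ∀ (g : G) (x : V × W), ρ g x = (ρ₁ g x.1, ρ₂ g x.2)) {n₁ n₂ : ℕ}
    (h₁ : CuspCountViaWeights χcyclo ρ₁ n₁) (h₂ : CuspCountViaWeights χcyclo ρ₂ n₂) (n : ℕ) :
    CuspCountViaWeights χcyclo ρ n ↔ (n : ℤ) = n₁ + n₂ - 1 := by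
  unfold CuspCountViaWeights at h₁ h₂ ⊢
  rw [quasiTrivialRank_twist_prod hρ, quasiTrivialRank_prod hρ]
  push_cast
  constructor <;> intro h <;> linarith

end DirectSum

end Literature.AnabelianGeometry.AbsoluteAnabelian.AbsTopI

end
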